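import Mathlib
import Literature.NumberTheory.Transcendental.KZCalculusProofs
import Literature.NumberTheory.Transcendental.KZLogCalculusProofs
import Literature.NumberTheory.Transcendental.KZHomotopyMoves
import Literature.NumberTheory.Transcendental.KZProductIdeal
import Literature.NumberTheory.Transcendental.KZSemialgebraicComplex
import Literature.NumberTheory.Transcendental.KZIdealTetrahedron
import Literature.NumberTheory.Transcendental.KZIntervalPeriodProofs
import Literature.NumberTheory.Transcendental.KZDominatedFamilyRelations
import Summits.KontsevichZagierPeriods.KontsevichZagierPeriods.Theorems.HyperbolicBlochOffTetraSectorKernelRungZeroLogRelations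
import Summits.KontsevichZagierPeriods.KontsevichZagierPeriods.Theorems.HyperbolicBlochOffTetraSectorKernelStubCarrierExistence

/-!
# `OffTetraSectorKernel`, line `odd-hyperbolic-ladder` (v9): carriers of Abel's five-term equation

Auxiliary existence lemmas for the lead's assembly `stub_abelFiveTerm` (Abel's five-term equation of
the real dilogarithm as Kontsevich–Zagier moves): Möbius functions of one coordinate are
`ℚ`-semialgebraic, bounded semialgebraic integrands on bounded semialgebraic sets are integral
representations, and the UNFOLDED-LOGARITHM BANDS `{lo < t < hi, 1 ≤ w ≤ V(t)}` with integrand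
`G(t)/w` (value `∫ G log V`) exist as soon as `|G| (V − 1)` is bounded (`log V ≤ V − 1`), via the
registered stub `stub_logBandExists`. Instances: the dilogarithm rectangle `(α,β) × (0,1)` with
`1/(1−us)` and the dilogarithm band `{α<u<β, 1 ≤ w ≤ 1/(1−u)}` with `(1/u)/w` (values `Li₂(β)−Li₂(α)`).

References: M. Kontsevich, D. Zagier, *Periods* (2001), §1.1–1.2.
-/

noncomputable section

open Set MeasureTheory
open Literature.NumberTheory.Transcendental Literature.ModelTheory.ExponentialFields

namespace Summit.KontsevichZagierPeriods.HyperbolicBloch.OffTetraSectorKernel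

/-! ### Semialgebraic atoms -/

/-- A Möbius function `(a xᵢ + b)/(c xᵢ + d)` of one coordinate, with real-algebraic coefficients and
non-vanishing denominator, is `ℚ`-semialgebraic. [cite: BochnakCosteRoy1998, Prop. 2.2.6] -/
theorem abel_isSemialgebraicFunOn_moebius {m : ℕ} {σ : Set (Fin m → ℝ)} (hσ : IsSemialgebraic ℚ σ)
    (i : Fin m) {a b c d : ℝ} (ha : IsAlgebraic ℚ a) (hb : IsAlgebraic ℚ b) (hc : IsAlgebraic ℚ c)
    (hd : IsAlgebraic ℚ d) (hden : ∀ p ∈ σ, c * p i + d ≠ 0) :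
    IsSemialgebraicFunOn ℚ σ (fun p => (a * p i + b) / (c * p i + d)) := by
  have hx : IsSemialgebraicFunOn ℚ σ (fun p => p i) := isSemialgebraicFunOn_apply hσ i
  have hnum : IsSemialgebraicFunOn ℚ σ (fun p => a * p i + b) :=
    (IsSemialgebraicFunOn.add_holds (IsSemialgebraicFunOn.mul_holds
      (isSemialgebraicFunOn_const_of_isAlgebraic hσ ha) hx)
      (isSemialgebraicFunOn_const_of_isAlgebraic hσ hb)).congr fun p _ => by simp
  have hdn : IsSemialgebraicFunOn ℚ σ (fun p => c * p i + d) :=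
    (IsSemialgebraicFunOn.add_holds (IsSemialgebraicFunOn.mul_holds
      (isSemialgebraicFunOn_const_of_isAlgebraic hσ hc) hx)
      (isSemialgebraicFunOn_const_of_isAlgebraic hσ hd)).congr fun p _ => by simp
  exact hnum.div hdn hden

/-- The open interval `{lo < t < hi} ⊆ ℝ¹` is bounded. [folklore] -/
theorem abel_isBounded_Ioo1 (lo hi : ℝ) :
    Bornology.IsBounded {p : Fin 1 → ℝ | lo < p 0 ∧ p 0 < hi} := by
  rw [isBounded_iff_forall_norm_le]
  refine ⟨max |lo| |hi|, fun p hp => ?_⟩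
  rw [pi_norm_le_iff_of_nonneg (le_max_of_le_left (abs_nonneg lo))]
  intro j
  have hj : j = 0 := Subsingleton.elim _ _
  subst hj
  rw [Real.norm_eq_abs, abs_le]
  obtain ⟨h1, h2⟩ := hp
  constructor
  · have : -max |lo| |hi| ≤ lo := by
      have := neg_abs_le lo
      have := le_max_left |lo| |hi|
      linarith
    linarith
  · have : hi ≤ max |lo| |hi| := (le_abs_self hi).trans (le_max_right _ _)
    linarith

/-- A box `{lo₀ < w₀ < hi₀, lo₁ < w₁ < hi₁} ⊆ ℝ²`-type set: anything contained in a product of bounded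
coordinate ranges is bounded. [folklore] -/
theorem abel_isBounded_of_abs_le {n : ℕ} {σ : Set (Fin n → ℝ)} (C : ℝ)
    (h : ∀ p ∈ σ, ∀ i, |p i| ≤ C) : Bornology.IsBounded σ := by
  rw [isBounded_iff_forall_norm_le]
  refine ⟨max C 0, fun p hp => ?_⟩
  rw [pi_norm_le_iff_of_nonneg (le_max_right _ _)]
  intro i
  rw [Real.norm_eq_abs]
  exact (h p hp i).trans (le_max_left _ _)

/-! ### Bounded integrands on bounded sets are representations -/

/-- **A bounded `ℚ`-semialgebraic function on a bounded `ℚ`-semialgebraic set IS an integral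
representation** (absolute integrability: finite measure times a uniform bound).
[cite: KontsevichZagier2001, §1.1] -/
theorem abel_exists_rep_of_bounded {n : ℕ} {σ : Set (Fin n → ℝ)} {f : (Fin n → ℝ) → ℝ}
    (hσ : IsSemialgebraic ℚ σ) (hbdd : Bornology.IsBounded σ) (hf : IsSemialgebraicFunOn ℚ σ f)
    {C : ℝ} (hC : ∀ x ∈ σ, |f x| ≤ C) :
    ∃ r : KZ.IntegralRep n, r.domain = σ ∧ r.integrand = f := by
  have hmeas : MeasurableSet σ := IsSemialgebraic.measurableSet_holds hσ
  have hint : IntegrableOn f σ := by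
    refine IntegrableOn.of_bound hbdd.measure_lt_top
      (KZ.aestronglyMeasurable_of_isSemialgebraicFunOn hf hmeas) C ?_
    rw [ae_restrict_iff' hmeas]
    exact Filter.Eventually.of_forall fun x hx => by
      rw [Real.norm_eq_abs]
      exact hC x hx
  exact ⟨⟨σ, f, hσ, hf, hint⟩, rfl, rfl⟩

/-! ### Unfolded-logarithm bands over an interval -/

/-- **The unfolded-logarithm band `[{lo < t < hi, 1 ≤ w ≤ V(t)}, G(t)/w]` exists** (value
`∫ G log V`) for `ℚ`-semialgebraic `G`, `V ≥ 1` on the interval with `|G| (V − 1)` bounded — since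
`log V ≤ V − 1` bounds the fibre integrals `|G(t)| log V(t)` (`stub_logBandExists`).
[cite: KontsevichZagier2001, §1.1] -/
theorem abel_exists_band {lo hi : ℝ} (hlo : IsAlgebraic ℚ lo) (hhi : IsAlgebraic ℚ hi)
    (G V : ℝ → ℝ) (C : ℝ)
    (hG : IsSemialgebraicFunOn ℚ {p : Fin 1 → ℝ | lo < p 0 ∧ p 0 < hi} (fun p => G (p 0)))
    (hV : IsSemialgebraicFunOn ℚ {p : Fin 1 → ℝ | lo < p 0 ∧ p 0 < hi} (fun p => V (p 0)))
    (hV1 : ∀ t, lo < t → t < hi → 1 ≤ V t)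
    (hb : ∀ t, lo < t → t < hi → |G t| * (V t - 1) ≤ C) :
    ∃ B : KZ.IntegralRep 2, B.domain = {z | (lo < z 0 ∧ z 0 < hi) ∧ 1 ≤ z 1 ∧ z 1 ≤ V (z 0)} ∧
      B.integrand = fun z => G (z 0) / z 1 := by
  set σ : Set (Fin 1 → ℝ) := {p | lo < p 0 ∧ p 0 < hi} with hσdef
  have hσ : IsSemialgebraic ℚ σ := isSemialgebraic_logIvl hlo hhi
  have hvol : volume σ ≠ ⊤ := (abel_isBounded_Ioo1 lo hi).measure_lt_top.ne
  have hV1' : ∀ p ∈ σ, 1 ≤ (fun p : Fin 1 → ℝ => V (p 0)) p := fun p hp => hV1 _ hp.1 hp.2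
  have hb' : ∀ p ∈ σ, |(fun p : Fin 1 → ℝ => G (p 0)) p| *
      Real.log ((fun p : Fin 1 → ℝ => V (p 0)) p) ≤ C := by
    intro p hp
    have h1 := hV1 _ hp.1 hp.2
    have hlog : Real.log (V (p 0)) ≤ V (p 0) - 1 :=
      Real.log_le_sub_one_of_pos (by linarith)
    exact (mul_le_mul_of_nonneg_left hlog (abs_nonneg _)).trans (hb _ hp.1 hp.2)
  obtain ⟨B, hBd, hBi⟩ := stub_logBandExists 1 σ (fun p => G (p 0)) (fun p => V (p 0)) C hσ hvol
    hG hV hV1' hb'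
  refine ⟨B, ?_, ?_⟩
  · rw [hBd]
    ext z
    simp only [mem_setOf_eq, hσdef, Fin.init, Fin.castSucc_zero, Fin.last]
    rfl
  · rw [hBi]
    funext z
    simp only [Fin.init, Fin.castSucc_zero, Fin.last]
    rfl

/-! ### The dilogarithm rectangle and band -/

/-- The rectangle `(α, β) × (0, 1) ⊆ ℝ²` is `ℚ`-semialgebraic for real-algebraic `α, β`.
[cite: KontsevichZagier2001, §1.1] -/
theorem abel_isSemialgebraic_rect {α β γ δ : ℝ} (hα : IsAlgebraic ℚ α) (hβ : IsAlgebraic ℚ β)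
    (hγ : IsAlgebraic ℚ γ) (hδ : IsAlgebraic ℚ δ) :
    IsSemialgebraic ℚ {w : Fin 2 → ℝ | α < w 0 ∧ w 0 < β ∧ γ < w 1 ∧ w 1 < δ} := by
  have hU : IsSemialgebraic ℚ (univ : Set (Fin 2 → ℝ)) := isSemialgebraic_univ
  have hco : ∀ i : Fin 2, IsSemialgebraicFunOn ℚ (univ : Set (Fin 2 → ℝ)) (fun p => p i) :=
    fun i => isSemialgebraicFunOn_apply hU i
  have hc : ∀ {c : ℝ}, IsAlgebraic ℚ c → IsSemialgebraicFunOn ℚ (univ : Set (Fin 2 → ℝ)) (fun _ => c) :=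
    fun h => isSemialgebraicFunOn_const_of_isAlgebraic hU h
  have S1 := isSemialgebraic_setOf_lt_of_isSemialgebraicFunOn (hc hα) (hco 0)
  have S2 := isSemialgebraic_setOf_lt_of_isSemialgebraicFunOn (hco 0) (hc hβ)
  have S3 := isSemialgebraic_setOf_lt_of_isSemialgebraicFunOn (hc hγ) (hco 1)
  have S4 := isSemialgebraic_setOf_lt_of_isSemialgebraicFunOn (hco 1) (hc hδ)
  convert S1.inter (S2.inter (S3.inter S4)) using 1
  ext w
  simp only [mem_inter_iff, mem_setOf_eq]

/-- **The dilogarithm rectangle `[(α,β) × (0,1), 1/(1 − u s)]` exists** for real-algebraic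
`0 ≤ α`, `β < 1` (bounded integrand `≤ 1/(1−β)`; value `Li₂(β) − Li₂(α)`).
[cite: KontsevichZagier2001, §1.1] -/
theorem abel_exists_dilogRect {α β : ℝ} (hα : IsAlgebraic ℚ α) (hβ : IsAlgebraic ℚ β)
    (h0 : 0 ≤ α) (h1 : β < 1) :
    ∃ R : KZ.IntegralRep 2, R.domain = {w | α < w 0 ∧ w 0 < β ∧ 0 < w 1 ∧ w 1 < 1} ∧
      R.integrand = fun w => 1 / (1 - w 0 * w 1) := by
  have hσ := abel_isSemialgebraic_rect hα hβ isAlgebraic_zero isAlgebraic_one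
  have hden : ∀ w ∈ {w : Fin 2 → ℝ | α < w 0 ∧ w 0 < β ∧ 0 < w 1 ∧ w 1 < 1}, 1 - β < 1 - w 0 * w 1 := by
    rintro w ⟨h1', h2, h3, h4⟩
    have : w 0 * w 1 < β := by
      have h5 : w 0 * w 1 ≤ w 0 * 1 := mul_le_mul_of_nonneg_left h4.le (by linarith)
      nlinarith
    linarith
  refine abel_exists_rep_of_bounded hσ (abel_isBounded_of_abs_le 1 ?_) ?_ (C := 1 / (1 - β)) ?_
  · rintro w ⟨h1', h2, h3, h4⟩ i
    fin_cases i
    · exact abs_le.2 ⟨by simp; linarith, by simp; linarith⟩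
    · exact abs_le.2 ⟨by simp; linarith, by simp; linarith⟩
  · have hU := hσ
    have hnum : IsSemialgebraicFunOn ℚ {w : Fin 2 → ℝ | α < w 0 ∧ w 0 < β ∧ 0 < w 1 ∧ w 1 < 1}
        (fun _ : Fin 2 → ℝ => (1 : ℝ)) := by
      simpa using isSemialgebraicFunOn_ratCast hU 1
    have hdn : IsSemialgebraicFunOn ℚ {w : Fin 2 → ℝ | α < w 0 ∧ w 0 < β ∧ 0 < w 1 ∧ w 1 < 1}
        (fun w : Fin 2 → ℝ => 1 - w 0 * w 1) :=
      (IsSemialgebraicFunOn.sub_holds hnum (IsSemialgebraicFunOn.mul_holds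
        (isSemialgebraicFunOn_apply hU 0) (isSemialgebraicFunOn_apply hU 1))).congr
        fun w _ => by simp
    exact hnum.div hdn fun w hw => by have := hden w hw; linarith
  · intro w hw
    have hpos : 0 < 1 - w 0 * w 1 := by have := hden w hw; linarith
    rw [abs_of_pos (one_div_pos.2 hpos)]
    exact one_div_le_one_div_of_le (by linarith) (hden w hw).le

/-- **The dilogarithm band `[{α<u<β, 1 ≤ w ≤ 1/(1−u)}, (1/u)/w]` exists** for real-algebraic
`0 ≤ α`, `β < 1` (`G = 1/u`, `V = 1/(1−u)`, `|G|(V−1) = 1/(1−u) ≤ 1/(1−β)`; value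
`Li₂(β) − Li₂(α)`). [cite: KontsevichZagier2001, §1.1] -/
theorem abel_exists_dilogBand :
    ∀ (α β : ℝ), IsAlgebraic ℚ α → IsAlgebraic ℚ β → 0 ≤ α → β < 1 →
      ∃ B : KZ.IntegralRep 2, B.domain = {w | α < w 0 ∧ w 0 < β ∧ 1 ≤ w 1 ∧ w 1 ≤ 1 / (1 - w 0)} ∧
        B.integrand = fun w => 1 / w 0 / w 1 := by
  intro α β hα hβ h0 h1
  have hσ : IsSemialgebraic ℚ {p : Fin 1 → ℝ | α < p 0 ∧ p 0 < β} := isSemialgebraic_logIvl hα hβ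
  have hG : IsSemialgebraicFunOn ℚ {p : Fin 1 → ℝ | α < p 0 ∧ p 0 < β} (fun p => 1 / p 0) := by
    have h := abel_isSemialgebraicFunOn_moebius hσ 0 isAlgebraic_zero isAlgebraic_one isAlgebraic_one
      isAlgebraic_zero (fun p hp => by have := hp.1; simp; linarith)
    exact h.congr fun p _ => by simp
  have hV : IsSemialgebraicFunOn ℚ {p : Fin 1 → ℝ | α < p 0 ∧ p 0 < β} (fun p => 1 / (1 - p 0)) := by
    have h := abel_isSemialgebraicFunOn_moebius hσ 0 isAlgebraic_zero isAlgebraic_one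
      (isAlgebraic_one.neg) isAlgebraic_one (fun p hp => by have := hp.2; simp; linarith)
    exact h.congr fun p _ => by simp; ring
  obtain ⟨B, hBd, hBi⟩ := abel_exists_band hα hβ (fun t => 1 / t) (fun t => 1 / (1 - t))
    (1 / (1 - β)) hG hV (fun t ht1 ht2 => by
      rw [le_div_iff₀ (by linarith)]; linarith) (fun t ht1 ht2 => by
      have ht0 : 0 < t := lt_of_le_of_lt h0 ht1
      have h1t : 0 < 1 - t := by linarith
      rw [abs_of_pos (one_div_pos.2 ht0)]
      have : 1 / t * (1 / (1 - t) - 1) = 1 / (1 - t) := by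
        field_simp
        ring
      rw [this]
      exact one_div_le_one_div_of_le (by linarith) (by linarith))
  refine ⟨B, ?_, hBi⟩
  rw [hBd]
  ext w
  simp only [mem_setOf_eq, and_assoc]

end Summit.KontsevichZagierPeriods.HyperbolicBloch.OffTetraSectorKernel

end
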